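import Summits.BirchSwinnertonDyer.BirchSwinnertonDyer.Theorems.KatoDescentPotSupersingularWildUpperUnitTwistRecordsSharpP31
import Summits.BirchSwinnertonDyer.BirchSwinnertonDyer.Theorems.KatoDescentPotSupersingularWildLowerDesc3RecordsX4ns01
import HarnessLib

/-!
# Route `KatoDescentPotSupersingular` (rung K9, sub-rung B5 = O6 wild `p = 3`, cell `bsd-potss`): BOTH halves of `ord₃ #Ш(E) = ord₃ #Ш(E)_an (= 2)`
# for the FIRST ♯ₚ row (single Tamagawa carrier = the wild prime 3: Kodaira IV*, `c₃ = 3`) with `#Ш(E)_an = 9`: 499230f1 — the UPPER half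
# from this seat's ♯ₚ unit-twist record (`missingUpperBoundAt_g499230f1_3`, file `…RecordsSharpP31`, road p610552, SCHEMA `hJp`
# displayed) and the LOWER half from k9-desc3's `3`-descent record `K9Desc3.lower3_sel_499230f1` (`…WildLowerDesc3RecordsX4ns01`)
# ⇒ Miller's `BSD(E,3)` MODULO THE SCHEMA (seat `bsd-potss-k9-c4` g17; `--supports stmt-BirchSwinnertonDyer-19197 --as helper`)

HONEST FRAMING. THEOREMS ONLY; PER PAIR; nothing booked here; items 19189 / 19197 / 19663 / 21422 stay OPEN class-wide; BSD is not proved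
for any class.  UNLIKE the six ♭ `…BsdpSha9*` pairs, this corollary is SCHEMA-CONDITIONAL: the upper half rests on the displayed
`q = p` two-split Jetchev–Kolyvagin bound `hJp` (= the body of the OPEN K9 aside crux 21422 `WildJetchevBoundAtPTwoSplit`; a kernel
theorem only modulo the four held named facts Matar–Nekovář 0.7, Gross 3.7 (2), Poitou–Tate, GZ86 III (3.1) and `PublishedInputsHeegner`,
k9-c4 g11 p564034) — so it is NOT an «F15-bookable pair» and is filed for what it shows: on a row where Jetchev's correction is
load-bearing (`c₃(E) = 3 = p`, `∏c_ℓ = 6`) the two per-row kernel records MEET EXACTLY — `ord₃ #Ш(E) ≥ 2` (Cassels–Tate + the displayed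
`3`-descent line `Sel^(3)(E/ℚ) ≠ ⊥`, k9-c2 kit j250472) and `ord₃ #Ш(E) ≤ ord₃ #Ш(E)_an = 2` (the ♯ₚ road at the unit rank-one twist
`d = −2999`, `#Ш_an(E^d) = 25`, this seat's kit j301922) —, the numerical consistency check of the ♯ₚ road's Tamagawa bookkeeping at a
row with non-trivial `Ш[3]`.  CONDITIONAL on every displayed hypothesis of both records (named facts `hCT hGZ hKo hGZK hmod`, the schema
`hJp`, Cremona's `N` / `r_an = 0` / `#Ш_an(E) = 9`, «tower not onto», the lattice-optimal datum with `3 ∤ c(D)`, the single-carrier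
clause `hcarrier`, the `3`-descent line `hSel`, the twist numerics).

References: [Jetchev2008] Conj. 1.3, Cor. 1.5; [MatarNekovar2019] Thm. 0.7, §0.11; [GrossZagier1986] I.6.3; [KolyvaginEulerSystems1990]
Thm. A; [MilneADT2006] Thm. I.7.3 (Cassels–Tate); [SchaeferStoll2004]; [Miller2011LMS] §1, Def. 1.1; [Cremona2006] Tables 1, 4.
-/

set_option autoImplicit false
set_option linter.dupNamespace false
noncomputable section
open scoped Classical NumberField
open WeierstrassCurve NumberField Field
  Literature.NumberTheory.EllipticCurves
  Literature.NumberTheory.EllipticCurves.ModularForms Literature.NumberTheory.EllipticCurves.Rank1Residual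
  Literature.NumberTheory.EllipticCurves.Rank1Residual.Typed Literature.NumberTheory.Automorphic
  Summit.BirchSwinnertonDyer.Rank1Residual Summit.BirchSwinnertonDyer.Rank1Residual.Additive
  Summit.BirchSwinnertonDyer.BirchSwinnertonDyer.Theorems

namespace Summit.BirchSwinnertonDyer.BirchSwinnertonDyer.Theorems.WildUpperUnitTwistRecords

/-- **`BSD(E,3)` (Miller) MODULO THE SCHEMA `hJp`, for the PAIR `E = 499230f1`, `p = 3`, with `#Ш(E)_an = 9`** — O6 wild `3`
(`N = 499230 = 2·3^3·5·43^2`), U₀-ns ♯ₚ row (mod-3 image Nn; `∏c_ℓ = 6`, single `3`-carrier = the prime `3` itself, `c₃ = 3`, Kodaira IV*),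
`r_an = 0`: LOWER half = `K9Desc3.lower3_sel_499230f1` (Cassels–Tate `hCT` + GZK + the displayed `3`-descent line `hSel`, kit j250472),
UPPER half = `missingUpperBoundAt_g499230f1_3` (♯ₚ road p610552: schema `hJp` + GZ + Kolyvagin + GZK + modularity + the unit rank-one
twist `d_K = −2999`, `#Ш_an(E^d) = 25`, kit j301922); together `ord₃ #Ш(E) = ord₃ #Ш(E)_an (= 2)` and GZK closes `BSD(E,3)`.
SCHEMA-CONDITIONAL (not F15); per pair; books nothing by itself. [cite: Miller2011LMS, §1 and Def. 1.1] [cite: Jetchev2008, Cor. 1.5 (p. 812)]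
[cite: MatarNekovar2019, Thm. 0.7 (p. 456)] [cite: MilneADT2006, Thm. I.7.3] [cite: Cremona2006, Table 4 (Cremona label 499230f1)] -/
theorem bsdp_g499230f1_3_of_sel3_of_schema
    (hCT : exists_casselsTate_pairing (K := ℚ))
    (hGZ : ∀ (N : ℕ) [NeZero N] (W : WeierstrassCurve ℚ) (K : Type) [Field K] [NumberField K],
      gross_zagier N W K)
    (hKo : ∀ (N : ℕ) [NeZero N] (W : WeierstrassCurve ℚ) (K : Type) [Field K] [NumberField K],
      kolyvagin N W K)
    (hGZK : rank_eq_analyticRank_of_analyticRank_le_one) (hmod : hasEntireLFunction_rat)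
    (hJp : ∀ (N : ℕ) [NeZero N] (W : WeierstrassCurve ℚ) [W.IsElliptic] [W.IsGloballyMinimal]
      (K : Type) [Field K] [NumberField K],
      IsImaginaryQuadratic K → NumberField.discr K ≠ -3 →
      SatisfiesHeegnerHypothesis N K → SatisfiesHeegnerHypothesis 2 K →
      ∀ (p : ℕ) [Fact p.Prime], p ≠ 2 → W.analyticRank = 0 → Addv W p → 0 ≤ padicValRat p W.j →
      ¬ W.HasCM → W.HasIrreducibleModPGaloisRep p →
      ¬ (∀ n : ℕ, W.HasSurjectiveModNGaloisRep (p ^ n : ℕ)) →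
      (∃ Dt : ModularParametrizationData W N,
        (∀ z ∈ Dt.L.lattice, ∃ w ∈ periodLattice Dt.f, z = (Dt.c : ℂ) * w) ∧ ¬ (p : ℤ) ∣ Dt.c) →
      ∀ {P : (W.baseChange K).toAffine.Point}, IsHeegnerPoint N W K P → ¬ IsOfFinAddOrder P → p ∣ N →
      padicValNat p (Nat.card (AddCommGroup.primaryComponent (W.baseChange K).sha p)) +
          2 * padicValNat p ((W.baseChange ℚ_[p]).localTamagawaNumber ℤ_[p]) ≤
        2 * padicValNat p (AddSubgroup.zmultiples P).index)
    {W : WeierstrassCurve ℚ} [W.IsElliptic] [W.IsGloballyMinimal] (hWeq : W = (⟨1, (-1), 0, (-105590265), (-283897440019)⟩ : WeierstrassCurve ℚ))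
    (hN : W.conductorNorm ℤ = 499230) (hr : W.analyticRank = 0)
    (hns : ¬ (∀ n : ℕ, W.HasSurjectiveModNGaloisRep (3 ^ n : ℕ)))
    (D : ModularParametrizationData W 499230) (hopt : ∀ z ∈ D.L.lattice, ∃ w ∈ periodLattice D.f, z = (D.c : ℂ) * w)
    (hc : ¬ (3 : ℤ) ∣ D.c)
    (hcarrier : padicValNat 3 W.tamagawaProduct ≤ padicValNat 3 ((W.baseChange ℚ_[3]).localTamagawaNumber ℤ_[3]))
    (K : Type) [Field K] [NumberField K] (hK : IsImaginaryQuadratic K) (hdK : NumberField.discr K = -2999)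
    {Wd : WeierstrassCurve ℚ} [Wd.IsElliptic] [Wd.IsGloballyMinimal] (hWdeq : Wd = (⟨1, (-1), 0, (-949678950686640), 7658280463638143257856⟩ : WeierstrassCurve ℚ))
    (hrd : Wd.analyticRank = 1) {qd : ℚ} (hqd : shaAn Wd = (qd : ℂ)) (hvd : padicValRat 3 qd ≤ 0)
    {s : ℚ} (hs : shaAn W = (s : ℂ)) (hv : padicValRat 3 s ≤ 2) (hSel : W.selmerGroup (3 : ℤ) ≠ ⊥) :
    BSDp W 3 :=
  bsdp_of_missingPPartAt W 3 hGZK (by rw [hr]; exact zero_le_one)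
    (missingPPartAt_of_lower_of_upper W 3 (K9Desc3.lower3_sel_499230f1 hCT hGZK W hWeq hr hs hv hSel)
      (missingUpperBoundAt_g499230f1_3 hGZ hKo hGZK hmod hJp hWeq hN hr hns D hopt hc hcarrier K hK hdK hWdeq hrd hqd hvd))

end Summit.BirchSwinnertonDyer.BirchSwinnertonDyer.Theorems.WildUpperUnitTwistRecords

end
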